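import Literature.Topology.FourManifolds.KirbyMovesSlideEndData
import Literature.Topology.FourManifolds.KirbyMovesSlideEndBaseLift
import Literature.Topology.FourManifolds.DehnSurgeryTwistProofs
import HarnessLib

/-!
# Normalising the band end: the band is transverse to the push-off circle in the normal coordinate

Topic `Literature/Topology/FourManifolds`; fact seat `provefact-IsStrictHandleSlide.isSurgery`
(R. C. Kirby, *The Topology of 4-Manifolds*, LNM 1374 (1989), Ch. I §4; remaining content: the
named fact (S) `Literature.Topology.FourManifolds.FramedLink.IsStrictHandleSlide.slideModel`).
Continuation of `KirbyMovesSlideEndData.lean`. The rotation which makes the slide band radial at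
the push-off `Kⱼ' = ν (·, e₀)` is by the angle between `e₀` and the `x₀`-derivative of the
**normal coordinate** `W x = (ν⁻¹ (band x)).2` of the band end; for this angle to be defined that
derivative must not vanish. Proved here (no definitions, no named facts):

* `Literature.Topology.FourManifolds.BandCore.fderiv_tubeNormal_ne_zero` — for a band core `b`
  from `A` to `ν.pushOff` and a height `y ∈ (1/10, 9/10)`:
  `D W (1, y) (1, 0) ≠ 0`. *Proof.* Near `x* = (1, y)` lift the base coordinate of `ν⁻¹ ∘ band`
  to an angle `Θ` without charts (`circlePoint_baseLift`: `Θ = θ* + arcsin (u* × U)`), so that in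
  `ℝ⁴` the band is `ν.coordMap ∘ (Θ, W)` (`DehnSurgeryTwistProofs.lean`); along the right edge
  `W ≡ e₀` and `Θ (1, y') = 2π thetaB y'`, so `D(band) (0, 1) = D(coordMap) (2π thetaB′, 0)`;
  if `D W (1, y) (1, 0) = 0` then also `D(band) (1, 0) = D(coordMap) (a, 0)`, and the nonzero
  vector `(2π thetaB′, -a)` would be killed by `D(band)`, contradicting the immersivity of the
  band read in `ℝ⁴` (`BandCore.fderiv_coe_band_ne_zero`).
* On the way: `contDiffOn_tubeNormal'`, `contDiffOn_tubeBaseCoe` (vector-space smoothness of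
  the two coordinates), `tubeNormal_eq_const_nhds` (`W (1, ·) = e₀` near `y`).

## References

* R. C. Kirby, *The Topology of 4-Manifolds*, LNM 1374, Springer (1989), Ch. I §4. [Kirby1989]
* M. W. Hirsch, *Differential Topology*, GTM 33 (1976), Ch. 4 §5 (tubular neighbourhoods). [HirschDT1976]
-/

open scoped Manifold ContDiff Topology
open Function Set Metric

noncomputable section

namespace Literature.Topology.FourManifolds

namespace BandCore

variable [Knot.TubularNbhd.SmoothnessFacts] {A Kj : Knot} (ν : Knot.TubularNbhd Kj)
  {avoid : Set (Metric.sphere (0 : EuclideanSpace ℝ (Fin 4)) 1)} (b : BandCore A ν.pushOff avoid)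

/-- The normal coordinate of the band end is `C^∞` in the vector-space sense on the open set of
parameters mapped into the tube. [folklore] -/
theorem contDiffOn_tubeNormal' :
    ContDiffOn ℝ ∞ (fun x ↦ (ν.toTubeNbhd.toHomeo.symm (b.band x)).2) (b.band ⁻¹' range ⇑ν) :=
  contMDiffOn_iff_contDiffOn.1 (b.contMDiffOn_tubeNormal ν)

/-- The base coordinate of the band end, read in `ℝ² ⊇ S¹`, is `C^∞` in the vector-space sense on
the same open set. [folklore] -/
theorem contDiffOn_tubeBaseCoe :
    ContDiffOn ℝ ∞ (fun x ↦ ((ν.toTubeNbhd.toHomeo.symm (b.band x)).1 : EuclideanSpace ℝ (Fin 2)))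
      (b.band ⁻¹' range ⇑ν) := by
  haveI := fact_finrank_euclideanSpace_succ 1
  have h := (contMDiff_coe_sphere (n := 1) (E := EuclideanSpace ℝ (Fin 2))).comp_contMDiffOn
    (contMDiff_fst.comp_contMDiffOn (b.contMDiffOn_tubeCoord ν))
  exact contMDiffOn_iff_contDiffOn.1 h

/-- The right-edge point `(1, y)`, `y ∈ (1/10, 9/10)`, lies in the square neighbourhood. [folklore] -/
theorem pt2_one_mem_squareNhd {y : ℝ} (hy : y ∈ Ioo (10⁻¹ : ℝ) (9 / 10)) : pt2 1 y ∈ squareNhd b.δ := by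
  have hδ := b.δ_pos
  intro i
  fin_cases i
  · show (1 : ℝ) ∈ Ioo (-b.δ) (1 + b.δ); constructor <;> linarith
  · show y ∈ Ioo (-b.δ) (1 + b.δ); constructor <;> linarith [hy.1, hy.2]

/-- **The band is transverse to the push-off circle in the normal coordinate**: at a right-edge
point `(1, y)`, `y ∈ (1/10, 9/10)`, the derivative of the normal coordinate
`W x = (ν⁻¹ (band x)).2` in the direction `(1, 0)` across the edge is nonzero. See the module
docstring for the proof. [cite: Kirby1989, Ch. I §4] -/
theorem fderiv_tubeNormal_ne_zero {y : ℝ} (hy : y ∈ Ioo (10⁻¹ : ℝ) (9 / 10)) :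
    fderiv ℝ (fun x ↦ (ν.toTubeNbhd.toHomeo.symm (b.band x)).2) (pt2 1 y) (pt2 1 0) ≠ 0 := by
  haveI := fact_finrank_euclideanSpace_succ 1
  haveI := fact_finrank_euclideanSpace_succ 3
  have hyc : y ∈ Icc (10⁻¹ : ℝ) (9 / 10) := Ioo_subset_Icc_self hy
  -- notation
  set xs : EuclideanSpace ℝ (Fin 2) := pt2 1 y with hxs
  set Wn : EuclideanSpace ℝ (Fin 2) → EuclideanSpace ℝ (Fin 2) :=
    fun x ↦ (ν.toTubeNbhd.toHomeo.symm (b.band x)).2 with hWn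
  set Uc : EuclideanSpace ℝ (Fin 2) → EuclideanSpace ℝ (Fin 2) :=
    fun x ↦ ((ν.toTubeNbhd.toHomeo.symm (b.band x)).1 : EuclideanSpace ℝ (Fin 2)) with hUc
  set F : EuclideanSpace ℝ (Fin 2) → EuclideanSpace ℝ (Fin 4) :=
    fun x ↦ ((b.band x : Metric.sphere (0 : EuclideanSpace ℝ (Fin 4)) 1) : EuclideanSpace ℝ (Fin 4)) with hF
  set θs : ℝ := 2 * Real.pi * b.thetaB y with hθs
  set O : Set (EuclideanSpace ℝ (Fin 2)) := b.band ⁻¹' range ⇑ν with hO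
  have hOo : IsOpen O := b.isOpen_preimage_range_tube ν
  have hxsO : xs ∈ O := b.band_pt2_one_mem_range ν hyc
  have hOn : O ∈ 𝓝 xs := hOo.mem_nhds hxsO
  -- smoothness at `xs`
  have hWns : ContDiffAt ℝ ∞ Wn xs := (b.contDiffOn_tubeNormal' ν).contDiffAt hOn
  have hUcs : ContDiffAt ℝ ∞ Uc xs := (b.contDiffOn_tubeBaseCoe ν).contDiffAt hOn
  have hFs : ContDiff ℝ ∞ F := b.contDiff_coe_band
  -- values on the right edge
  have hedge : ∀ y' ∈ Icc (10⁻¹ : ℝ) (9 / 10),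
      ν.toTubeNbhd.toHomeo.symm (b.band (pt2 1 y')) = (circlePt (b.thetaB y'), framingBaseVector) :=
    fun y' hy' ↦ b.tubeCoord_band_pt2_one ν hy'
  have hWn_edge : ∀ y' ∈ Icc (10⁻¹ : ℝ) (9 / 10), Wn (pt2 1 y') = framingBaseVector := fun y' hy' ↦ by
    simp only [hWn, hedge y' hy']
  have hUc_edge : ∀ y' ∈ Icc (10⁻¹ : ℝ) (9 / 10),
      Uc (pt2 1 y') = ((circlePt (b.thetaB y') : Metric.sphere (0 : EuclideanSpace ℝ (Fin 2)) 1) :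
        EuclideanSpace ℝ (Fin 2)) := fun y' hy' ↦ by
    simp only [hUc, hedge y' hy']
  have hUc_xs0 : Uc xs 0 = Real.cos θs := by rw [hUc_edge y hyc, circlePt_apply_zero]
  have hUc_xs1 : Uc xs 1 = Real.sin θs := by rw [hUc_edge y hyc, circlePt_apply_one]
  -- the chart-free local lift of the base angle
  set arg : EuclideanSpace ℝ (Fin 2) → ℝ := fun x ↦ Real.cos θs * Uc x 1 - Real.sin θs * Uc x 0 with harg
  set Θ : EuclideanSpace ℝ (Fin 2) → ℝ := fun x ↦ θs + Real.arcsin (arg x) with hΘ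
  have harg_xs : arg xs = 0 := by simp only [harg, hUc_xs0, hUc_xs1]; ring
  have hargs : ContDiffAt ℝ ∞ arg xs := by
    have h0 : ContDiffAt ℝ ∞ (fun x ↦ Uc x 0) xs := (contDiff_euclidean.1 contDiff_id 0).contDiffAt.comp xs hUcs
    have h1 : ContDiffAt ℝ ∞ (fun x ↦ Uc x 1) xs := (contDiff_euclidean.1 contDiff_id 1).contDiffAt.comp xs hUcs
    exact (contDiffAt_const.mul h1).sub (contDiffAt_const.mul h0)
  have hΘs : ContDiffAt ℝ ∞ Θ xs := by
    refine contDiffAt_const.add ?_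
    have ha : ContDiffAt ℝ ∞ Real.arcsin (arg xs) := by
      rw [harg_xs]; exact Real.contDiffAt_arcsin (by norm_num) (by norm_num)
    exact ha.comp xs hargs
  -- positivity of `⟪u*, U x⟫` near `xs`, hence the lift property and the local factorisation
  set ip : EuclideanSpace ℝ (Fin 2) → ℝ := fun x ↦ Real.cos θs * Uc x 0 + Real.sin θs * Uc x 1 with hip
  have hip_xs : ip xs = 1 := by
    simp only [hip, hUc_xs0, hUc_xs1]
    nlinarith [Real.cos_sq_add_sin_sq θs]
  have hipc : ContinuousAt ip xs := by
    have h0 : ContinuousAt (fun x ↦ Uc x 0) xs :=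
      ((contDiff_euclidean.1 contDiff_id 0).contDiffAt.comp xs hUcs).continuousAt
    have h1 : ContinuousAt (fun x ↦ Uc x 1) xs :=
      ((contDiff_euclidean.1 contDiff_id 1).contDiffAt.comp xs hUcs).continuousAt
    exact (continuousAt_const.mul h0).add (continuousAt_const.mul h1)
  have hpos_ev : ∀ᶠ x in 𝓝 xs, 0 < ip x :=
    hipc.eventually (p := fun r ↦ 0 < r) (by rw [hip_xs]; exact Ioi_mem_nhds one_pos)
  -- the local factorisation `F = coordMap ∘ (Θ, Wn)` near `xs`
  have hfact : ∀ᶠ x in 𝓝 xs, F x = ν.coordMap (Θ x, Wn x) := by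
    filter_upwards [hpos_ev, hOn] with x hx hxO
    have hlift : circlePoint (Θ x) = (ν.toTubeNbhd.toHomeo.symm (b.band x)).1 := by
      have := SlideSweep.circlePoint_baseLift θs (ν.toTubeNbhd.toHomeo.symm (b.band x)).1 hx
      simpa only [hΘ, harg] using this
    rw [Knot.TubularNbhd.coordMap_apply, hlift]
    show ((b.band x : Metric.sphere (0 : EuclideanSpace ℝ (Fin 4)) 1) : EuclideanSpace ℝ (Fin 4)) =
      ((ν ((ν.toTubeNbhd.toHomeo.symm (b.band x)).1, (ν.toTubeNbhd.toHomeo.symm (b.band x)).2) :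
        Metric.sphere (0 : EuclideanSpace ℝ (Fin 4)) 1) : EuclideanSpace ℝ (Fin 4))
    congr 1
    rw [Prod.mk.eta]
    have htgt : b.band x ∈ ν.toTubeNbhd.toHomeo.target := by
      rw [TubeNbhd.toHomeo_target]
      have hxO' : b.band x ∈ range ⇑ν := hxO
      obtain ⟨q, hq⟩ := hxO'
      exact ⟨q, by rw [Knot.TubularNbhd.toTubeNbhd_toFun]; exact hq⟩
    have h := ν.toTubeNbhd.toHomeo.right_inv htgt
    rw [TubeNbhd.toHomeo_apply, Knot.TubularNbhd.toTubeNbhd_toFun] at h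
    exact h.symm
  -- derivative of `F` at `xs` through the factorisation
  set G : EuclideanSpace ℝ (Fin 2) → ℝ × EuclideanSpace ℝ (Fin 2) := fun x ↦ (Θ x, Wn x) with hG
  have hGd : DifferentiableAt ℝ G xs :=
    (hΘs.differentiableAt (by simp)).prodMk (hWns.differentiableAt (by simp))
  have hWn_xs : Wn xs = framingBaseVector := hWn_edge y hyc
  have hG_xs : G xs = (θs, framingBaseVector) := by
    simp only [hG, hΘ, harg_xs, Real.arcsin_zero, add_zero, hWn_xs]
  have hQd : DifferentiableAt ℝ ν.coordMap (G xs) := ν.differentiable_coordMap _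
  have hcomp : HasFDerivAt (fun x ↦ ν.coordMap (G x))
      ((fderiv ℝ ν.coordMap (G xs)).comp (fderiv ℝ G xs)) xs :=
    hQd.hasFDerivAt.comp xs hGd.hasFDerivAt
  have hFd : HasFDerivAt F ((fderiv ℝ ν.coordMap (G xs)).comp (fderiv ℝ G xs)) xs :=
    hcomp.congr_of_eventuallyEq hfact
  have hF' : fderiv ℝ F xs = (fderiv ℝ ν.coordMap (G xs)).comp (fderiv ℝ G xs) := hFd.fderiv
  have hG' : ∀ v, fderiv ℝ G xs v = (fderiv ℝ Θ xs v, fderiv ℝ Wn xs v) := fun v ↦ by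
    rw [show G = fun x ↦ (Θ x, Wn x) from rfl,
      DifferentiableAt.fderiv_prodMk (hΘs.differentiableAt (by simp)) (hWns.differentiableAt (by simp))]
    rfl
  -- along the edge: `Wn (1, y') = e₀`, `Θ (1, y') = 2π thetaB y'` near `y`
  have hIoo : Ioo (10⁻¹ : ℝ) (9 / 10) ∈ 𝓝 y := Ioo_mem_nhds hy.1 hy.2
  have hγ : HasDerivAt (fun y' : ℝ ↦ pt2 1 y') (pt2 0 1) y := by
    have := hasDerivAt_pt2 (hasDerivAt_const y (1 : ℝ)) (hasDerivAt_id y)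
    simpa using this
  have hWnD : HasFDerivAt Wn (fderiv ℝ Wn xs) (pt2 1 y) := (hWns.differentiableAt (by simp)).hasFDerivAt
  have hΘD : HasFDerivAt Θ (fderiv ℝ Θ xs) (pt2 1 y) := (hΘs.differentiableAt (by simp)).hasFDerivAt
  have hWn_line : HasDerivAt (Wn ∘ fun y' : ℝ ↦ pt2 1 y') (fderiv ℝ Wn xs (pt2 0 1)) y :=
    hWnD.comp_hasDerivAt y hγ
  have hWn_line0 : HasDerivAt (Wn ∘ fun y' : ℝ ↦ pt2 1 y') 0 y := by
    refine (hasDerivAt_const y framingBaseVector).congr_of_eventuallyEq ?_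
    filter_upwards [hIoo] with y' hy'
    exact hWn_edge y' (Ioo_subset_Icc_self hy')
  have hWn01 : fderiv ℝ Wn xs (pt2 0 1) = 0 := hWn_line.unique hWn_line0
  have hΘ_line : HasDerivAt (Θ ∘ fun y' : ℝ ↦ pt2 1 y') (fderiv ℝ Θ xs (pt2 0 1)) y :=
    hΘD.comp_hasDerivAt y hγ
  -- `Θ (1, y') = 2π thetaB y'` for `y'` near `y`
  have hthB : ContDiffAt ℝ ∞ b.thetaB y := b.contDiffAt_thetaB hy
  have hthBc : ContinuousAt b.thetaB y := hthB.continuousAt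
  have hclose : ∀ᶠ y' in 𝓝 y, |2 * Real.pi * b.thetaB y' - θs| < Real.pi / 2 := by
    have hc : ContinuousAt (fun y' ↦ 2 * Real.pi * b.thetaB y' - θs) y :=
      (continuousAt_const.mul hthBc).sub continuousAt_const
    have h0 : (fun y' ↦ 2 * Real.pi * b.thetaB y' - θs) y = 0 := by simp [hθs]
    have := hc.eventually (p := fun r ↦ |r| < Real.pi / 2)
      (by rw [h0]; exact (continuous_abs.isOpen_preimage _ isOpen_Iio).mem_nhds (by simp [Real.pi_pos]))
    exact this
  have hΘ_edge : ∀ᶠ y' in 𝓝 y, (Θ ∘ fun y' : ℝ ↦ pt2 1 y') y' = 2 * Real.pi * b.thetaB y' := by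
    filter_upwards [hIoo, hclose] with y' hy' hcl
    have hU0 : Uc (pt2 1 y') 0 = Real.cos (2 * Real.pi * b.thetaB y') := by
      rw [hUc_edge y' (Ioo_subset_Icc_self hy'), circlePt_apply_zero]
    have hU1 : Uc (pt2 1 y') 1 = Real.sin (2 * Real.pi * b.thetaB y') := by
      rw [hUc_edge y' (Ioo_subset_Icc_self hy'), circlePt_apply_one]
    have harg' : arg (pt2 1 y') = Real.sin (2 * Real.pi * b.thetaB y' - θs) := by
      simp only [harg, hU0, hU1, Real.sin_sub]; ring
    simp only [comp_apply, hΘ, harg']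
    rw [Real.arcsin_sin (by linarith [(abs_lt.1 hcl).1]) (by linarith [(abs_lt.1 hcl).2])]
    ring
  have hΘ_line' : HasDerivAt (Θ ∘ fun y' : ℝ ↦ pt2 1 y') (2 * Real.pi * deriv b.thetaB y) y := by
    have hd : HasDerivAt (fun y' ↦ 2 * Real.pi * b.thetaB y') (2 * Real.pi * deriv b.thetaB y) y :=
      ((hthB.differentiableAt (by simp)).hasDerivAt).const_mul _
    exact hd.congr_of_eventuallyEq hΘ_edge
  set c : ℝ := 2 * Real.pi * deriv b.thetaB y with hc
  have hΘ01 : fderiv ℝ Θ xs (pt2 0 1) = c := hΘ_line.unique hΘ_line'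
  have hc0 : c ≠ 0 := by
    have := b.deriv_thetaB_neg hy
    have hπ := Real.pi_pos
    simp only [hc]
    nlinarith
  -- the contradiction
  intro hW10
  change fderiv ℝ Wn xs (pt2 1 0) = 0 at hW10
  set a : ℝ := fderiv ℝ Θ xs (pt2 1 0) with ha
  set v : EuclideanSpace ℝ (Fin 2) := c • pt2 1 0 - a • pt2 0 1 with hv
  have hv0 : v ≠ 0 := by
    intro h
    have := congrArg (fun w : EuclideanSpace ℝ (Fin 2) ↦ w 0) h
    simp [hv, pt2] at this
    exact hc0 this
  have hFv : fderiv ℝ F xs v = 0 := by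
    rw [hF', ContinuousLinearMap.comp_apply, map_sub, map_smul, map_smul, hG', hG', hΘ01, hW10, hWn01]
    simp only [← ha]
    rw [map_sub, map_smul, map_smul]
    have : c • fderiv ℝ ν.coordMap (G xs) ((a, (0 : EuclideanSpace ℝ (Fin 2))) : ℝ × EuclideanSpace ℝ (Fin 2)) =
        a • fderiv ℝ ν.coordMap (G xs) ((c, (0 : EuclideanSpace ℝ (Fin 2))) : ℝ × EuclideanSpace ℝ (Fin 2)) := by
      rw [← map_smul, ← map_smul]
      congr 1
      ext <;> simp [mul_comm]
    rw [this, sub_self]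
  exact b.fderiv_coe_band_ne_zero (b.pt2_one_mem_squareNhd ν hy) hv0 hFv

end BandCore

end Literature.Topology.FourManifolds
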